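import Mathlib
import Literature.Computability.AlgebraicComplexity.NewtonPolygonTau

/-!
# Crux `WordPerSuperPoly` (stmt-ValiantsHypothesis-6626), line `Sketch`, stub S2
# (`stub_cancellationSubexp`): the registered form is the weakest of the card's C⁺ forms

Stub S2 of the line asks, for every `ε > 0`, for a constant `A` with
`#vert Newt(entry w) ≤ A · 2^{L^ε} · #vert Newt(entry w¹)` for every sparse bivariate word `w` of
length `L` (`w¹` its all-ones companion).  This file proves that S2 is IMPLIED by the absolute
bounds one would naturally conjecture, so that a proof of any of them closes the line and a
refutation of S2 refutes all of them:

* `newtonVertexCount_eq_zero_iff` — a bivariate polynomial has no Newton vertices iff it is `0`;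
* `support_subset_companion` — cancellation only removes points (`supp(entry w) ⊆ supp(entry w¹)`,
  for ALL words, zero coefficients allowed), hence `#vert(entry w¹) = 0 → #vert(entry w) = 0`;
* `cancellationSubexp_of_absolute` — the absolute subexponential form
  `∀ ε > 0 ∃ A ∀ w, #vert(entry w) ≤ A · 2^{L^ε}` implies S2;
* `poly_le_mul_two_rpow` + `cancellationSubexp_of_poly` — the polynomial form
  `∃ c ∀ w, #vert(entry w) ≤ c (L+1)^c` (the card's `NewtonWordTauPoly`) implies S2.

Helper file (`--supports stmt-ValiantsHypothesis-6626`) of the line lead; S2 itself stays open.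
-/

noncomputable section

-- `Summit.ValiantsHypothesis.ValiantsHypothesis.…` is the tree's mandated single-conjunct layout.
set_option linter.dupNamespace false

namespace Summit.ValiantsHypothesis.ValiantsHypothesis.Theorems.ElementaryWordLengthWordPerSuperPoly

open MvPolynomial Literature.Computability.AlgebraicComplexity

/-- `sparseMat⟦w⟧` (local notation, not a definition): the matrix of a sparse bivariate word. -/
local notation3 (prettyPrint := false) "sparseMat⟦" w "⟧" =>
  List.prod (List.map (fun l : Fin 3 × Fin 3 × ℂ × (ℕ × ℕ) =>
    Matrix.transvection l.1 l.2.1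
      (MvPolynomial.C l.2.2.1 * (MvPolynomial.X 0 ^ l.2.2.2.1 * MvPolynomial.X 1 ^ l.2.2.2.2) :
        MvPolynomial (Fin 2) ℂ)) w)

/-- `comp⟦w⟧` (local notation, not a definition): the all-ones companion word. -/
local notation3 (prettyPrint := false) "comp⟦" w "⟧" =>
  List.map (fun l : Fin 3 × Fin 3 × ℂ × (ℕ × ℕ) => (l.1, l.2.1, (1 : ℂ), l.2.2.2)) w

namespace CancellationForms

/-- A sparse letter `C c * (X^a Y^b)` is the monomial `monomial (single 0 a + single 1 b) c`. [folklore] -/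
theorem letter_eq_monomial (c : ℂ) (a b : ℕ) :
    (C c * (X 0 ^ a * X 1 ^ b) : MvPolynomial (Fin 2) ℂ) =
      monomial (Finsupp.single 0 a + Finsupp.single 1 b) c := by
  rw [X_pow_eq_monomial, X_pow_eq_monomial, monomial_mul, C_mul_monomial]
  simp

/-- **Path-count bookkeeping (all words).** Every coefficient of every entry of the matrix of a
sparse word is the sum of a multiset of complex numbers (the weights of the admissible paths) whose
cardinality is the corresponding coefficient of the all-ones companion. [folklore] -/
theorem coeff_multiset_card (w : List (Fin 3 × Fin 3 × ℂ × (ℕ × ℕ))) :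
    ∀ (p q : Fin 3) (e : Fin 2 →₀ ℕ), ∃ s : Multiset ℂ,
      coeff e (sparseMat⟦w⟧ p q) = s.sum ∧ coeff e (sparseMat⟦comp⟦w⟧⟧ p q) = (Multiset.card s : ℂ) := by
  induction w with
  | nil =>
    intro p q e
    simp only [List.map_nil, List.prod_nil]
    by_cases hpq : p = q
    · subst hpq
      by_cases he : e = 0
      · subst he
        refine ⟨{1}, ?_, ?_⟩ <;> simp
      · refine ⟨0, ?_, ?_⟩ <;> simp [MvPolynomial.coeff_one, Ne.symm he]
    · refine ⟨0, ?_, ?_⟩ <;> simp [hpq]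
  | cons l w ih =>
    intro p q e
    simp only [List.map_cons, List.prod_cons]
    set d : Fin 2 →₀ ℕ := Finsupp.single 0 l.2.2.2.1 + Finsupp.single 1 l.2.2.2.2 with hd
    by_cases hp : p = l.1
    · subst hp
      obtain ⟨s₁, hsum₁, hcard₁⟩ := ih l.1 q e
      obtain ⟨s₂, hsum₂, hcard₂⟩ := ih l.2.1 q (e - d)
      refine ⟨s₁ + (if d ≤ e then s₂.map (fun z => l.2.2.1 * z) else 0), ?_, ?_⟩
      · rw [Matrix.transvection_mul_apply_same, coeff_add, letter_eq_monomial, ← hd,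
          coeff_monomial_mul', Multiset.sum_add, hsum₁]
        congr 1
        split_ifs with hde
        · rw [Multiset.sum_map_mul_left, Multiset.map_id', ← hsum₂]
        · simp
      · rw [Matrix.transvection_mul_apply_same, coeff_add, letter_eq_monomial, ← hd,
          coeff_monomial_mul', Multiset.card_add, hcard₁]
        push_cast
        congr 1
        split_ifs with hde
        · rw [Multiset.card_map, one_mul, ← hcard₂]
        · simp
    · obtain ⟨s₁, hsum₁, hcard₁⟩ := ih p q e
      refine ⟨s₁, ?_, ?_⟩
      · rw [Matrix.transvection_mul_apply_of_ne (ha := hp), hsum₁]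
      · rw [Matrix.transvection_mul_apply_of_ne (ha := hp), hcard₁]

/-- **Cancellation only removes points** (all words, zero coefficients allowed): the support of
every entry is contained in the support of the same entry of the all-ones companion. [folklore] -/
theorem support_subset_companion (w : List (Fin 3 × Fin 3 × ℂ × (ℕ × ℕ))) (p q : Fin 3) :
    (sparseMat⟦w⟧ p q).support ⊆ (sparseMat⟦comp⟦w⟧⟧ p q).support := by
  intro e he
  rw [mem_support_iff] at he ⊢
  obtain ⟨s, hsum, hcard⟩ := coeff_multiset_card w p q e
  rw [hcard]
  have hs0 : s ≠ 0 := by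
    rintro rfl
    rw [hsum, Multiset.sum_zero] at he
    exact he rfl
  exact_mod_cast (Multiset.card_pos.2 hs0).ne'

/-- **A bivariate polynomial has no Newton vertices iff it is zero** (a nonempty compact convex
set has an extreme point). [folklore] -/
theorem newtonVertexCount_eq_zero_iff (f : MvPolynomial (Fin 2) ℂ) :
    newtonVertexCount f = 0 ↔ f = 0 := by
  constructor
  · intro h
    by_contra hf
    have hne : ((f.support : Set (Fin 2 →₀ ℕ))).Nonempty := by
      rw [Finset.coe_nonempty, Finset.nonempty_iff_ne_empty, Ne, MvPolynomial.support_eq_empty]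
      exact hf
    set S : Set (Fin 2 → ℝ) :=
      (fun e : Fin 2 →₀ ℕ => fun i : Fin 2 => ((e i : ℕ) : ℝ)) '' (f.support : Set (Fin 2 →₀ ℕ))
      with hS
    have hSfin : S.Finite := (f.support.finite_toSet).image _
    have hSne : S.Nonempty := hne.image _
    have hcomp : IsCompact (convexHull ℝ S) := hSfin.isCompact_convexHull ℝ
    have hext : ((convexHull ℝ S).extremePoints ℝ).Nonempty :=
      hcomp.extremePoints_nonempty (hSne.mono (subset_convexHull ℝ S))
    have hfin : ((convexHull ℝ S).extremePoints ℝ).Finite :=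
      hSfin.subset extremePoints_convexHull_subset
    have hpos : 0 < ((convexHull ℝ S).extremePoints ℝ).ncard := (Set.ncard_pos hfin).2 hext
    exact hpos.ne' h
  · rintro rfl
    simp [newtonVertexCount, MvPolynomial.support_zero, extremePoints_empty]

/-- If the companion's `(0,2)` entry has no Newton vertices, neither has the word's. [folklore] -/
theorem newtonVertexCount_eq_zero_of_companion (w : List (Fin 3 × Fin 3 × ℂ × (ℕ × ℕ)))
    (h : newtonVertexCount (sparseMat⟦comp⟦w⟧⟧ 0 2) = 0) :
    newtonVertexCount (sparseMat⟦w⟧ 0 2) = 0 := by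
  rw [newtonVertexCount_eq_zero_iff] at h ⊢
  have hsub := support_subset_companion w 0 2
  rw [h, MvPolynomial.support_zero, Finset.subset_empty, MvPolynomial.support_eq_empty] at hsub
  exact hsub

/-- **Polynomials are below every stretched exponential**: for `c : ℕ` and `ε > 0` there is `A`
with `c (L+1)^c ≤ A · 2^{L^ε}` for all `L : ℕ` (via `x^s ≤ (s/b)^s e^{bx}`, i.e.
`log y ≤ y - 1`). [folklore] -/
theorem poly_le_mul_two_rpow (c : ℕ) {ε : ℝ} (hε : 0 < ε) :
    ∃ A : ℝ, 0 ≤ A ∧ ∀ L : ℕ, (c : ℝ) * ((L : ℝ) + 1) ^ c ≤ A * (2 : ℝ) ^ ((L : ℝ) ^ ε) := by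
  -- the exponent `s = c / ε` and the rate `b = log 2`
  set b : ℝ := Real.log 2 with hb_def
  have hb : 0 < b := Real.log_pos (by norm_num)
  set s : ℝ := (c : ℝ) / ε with hs_def
  have hs0 : 0 ≤ s := by positivity
  -- key inequality: `x^s ≤ (s/b)^s * exp (b x)` for `x > 0` (trivial for `s = 0`)
  have key : ∀ x : ℝ, 0 < x → x ^ s ≤ (s / b) ^ s * Real.exp (b * x) := by
    intro x hx
    rcases hs0.eq_or_lt with hs00 | hspos
    · rw [← hs00, Real.rpow_zero, Real.rpow_zero, one_mul]
      exact Real.one_le_exp (by positivity)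
    · have hsb : 0 < s / b := div_pos hspos hb
      -- `log (x / (s/b)) ≤ x / (s/b) - 1`, multiplied by `s`
      have h1 := Real.log_le_sub_one_of_pos (div_pos hx hsb)
      rw [Real.log_div hx.ne' hsb.ne'] at h1
      have h2 : s * (Real.log x - Real.log (s / b)) ≤ s * (x / (s / b) - 1) :=
        mul_le_mul_of_nonneg_left h1 hs0
      have h3 : s * (x / (s / b) - 1) = b * x - s := by field_simp
      rw [h3] at h2
      have h4 : s * Real.log x ≤ s * Real.log (s / b) + b * x := by linarith
      calc x ^ s = Real.exp (s * Real.log x) := by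
            rw [Real.rpow_def_of_pos hx, mul_comm]
        _ ≤ Real.exp (s * Real.log (s / b) + b * x) := Real.exp_le_exp.2 h4
        _ = (s / b) ^ s * Real.exp (b * x) := by
            rw [Real.exp_add, Real.rpow_def_of_pos hsb, mul_comm (Real.log (s / b))]
  refine ⟨(c : ℝ) * 2 ^ c * (s / b) ^ s + c, by positivity, fun L => ?_⟩
  have h2pow : ∀ y : ℝ, (2 : ℝ) ^ y = Real.exp (b * y) := fun y => by
    rw [Real.rpow_def_of_pos (by norm_num : (0 : ℝ) < 2), hb_def]
  rcases Nat.eq_zero_or_pos L with hL | hL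
  · subst hL
    simp only [Nat.cast_zero, zero_add, one_pow, mul_one, Real.zero_rpow hε.ne', Real.rpow_zero]
    have : (0 : ℝ) ≤ (c : ℝ) * 2 ^ c * (s / b) ^ s := by positivity
    linarith
  · have hL1 : (1 : ℝ) ≤ L := by exact_mod_cast hL
    have hLpos : (0 : ℝ) < L := by linarith
    set x : ℝ := (L : ℝ) ^ ε with hx_def
    have hxpos : 0 < x := Real.rpow_pos_of_pos hLpos ε
    -- `(L+1)^c ≤ 2^c L^c = 2^c x^s`
    have hLc : (L : ℝ) ^ (c : ℕ) = x ^ s := by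
      rw [hx_def, ← Real.rpow_mul hLpos.le, hs_def, mul_div_cancel₀ _ hε.ne', Real.rpow_natCast]
    have h1 : ((L : ℝ) + 1) ^ c ≤ (2 : ℝ) ^ c * x ^ s := by
      rw [← hLc, ← mul_pow]
      exact pow_le_pow_left₀ (by positivity) (by linarith) c
    have h2 := key x hxpos
    have hexp : Real.exp (b * x) = (2 : ℝ) ^ x := (h2pow x).symm
    rw [hexp] at h2
    have h2x : (0 : ℝ) < (2 : ℝ) ^ x := Real.rpow_pos_of_pos (by norm_num) x
    calc (c : ℝ) * ((L : ℝ) + 1) ^ c ≤ (c : ℝ) * ((2 : ℝ) ^ c * x ^ s) :=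
          mul_le_mul_of_nonneg_left h1 (Nat.cast_nonneg c)
      _ ≤ (c : ℝ) * ((2 : ℝ) ^ c * ((s / b) ^ s * (2 : ℝ) ^ x)) := by gcongr
      _ = ((c : ℝ) * 2 ^ c * (s / b) ^ s) * (2 : ℝ) ^ x := by ring
      _ ≤ ((c : ℝ) * 2 ^ c * (s / b) ^ s + c) * (2 : ℝ) ^ x := by
          apply mul_le_mul_of_nonneg_right _ h2x.le
          linarith [(Nat.cast_nonneg c : (0 : ℝ) ≤ c)]
      _ ≤ ((c : ℝ) * 2 ^ c * (s / b) ^ s + c) * (2 : ℝ) ^ x := le_rfl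

end CancellationForms

open CancellationForms in
/-- **The absolute subexponential form implies S2.** If for every `ε > 0` the `(0,2)` entries of
all sparse bivariate words of length `L` have at most `A_ε · 2^{L^ε}` Newton vertices, then the
registered stub `stub_cancellationSubexp` holds (with `max A_ε 0`): the companion has at least one
vertex unless both counts vanish. [folklore] -/
theorem cancellationSubexp_of_absolute
    (habs : ∀ ε : ℝ, 0 < ε → ∃ A : ℝ, ∀ w : List (Fin 3 × Fin 3 × ℂ × (ℕ × ℕ)),
      (∀ l ∈ w, l.1 ≠ l.2.1) →
      (newtonVertexCount (sparseMat⟦w⟧ 0 2) : ℝ) ≤ A * (2 : ℝ) ^ ((w.length : ℝ) ^ ε)) :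
    ∀ ε : ℝ, 0 < ε → ∃ A : ℝ, ∀ w : List (Fin 3 × Fin 3 × ℂ × (ℕ × ℕ)), (∀ l ∈ w, l.1 ≠ l.2.1) →
      (newtonVertexCount (sparseMat⟦w⟧ 0 2) : ℝ) ≤
        A * (2 : ℝ) ^ ((w.length : ℝ) ^ ε) * (newtonVertexCount (sparseMat⟦comp⟦w⟧⟧ 0 2) : ℝ) := by
  intro ε hε
  obtain ⟨A, hA⟩ := habs ε hε
  refine ⟨max A 0, fun w hw => ?_⟩
  have hpow : (0 : ℝ) ≤ (2 : ℝ) ^ ((w.length : ℝ) ^ ε) := by positivity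
  by_cases h0 : newtonVertexCount (sparseMat⟦comp⟦w⟧⟧ 0 2) = 0
  · rw [newtonVertexCount_eq_zero_of_companion w h0, h0]
    simp
  · have h1 : (1 : ℝ) ≤ (newtonVertexCount (sparseMat⟦comp⟦w⟧⟧ 0 2) : ℝ) := by
      exact_mod_cast Nat.one_le_iff_ne_zero.2 h0
    have hA0 : 0 ≤ max A 0 * (2 : ℝ) ^ ((w.length : ℝ) ^ ε) := mul_nonneg (le_max_right _ _) hpow
    calc (newtonVertexCount (sparseMat⟦w⟧ 0 2) : ℝ) ≤ A * (2 : ℝ) ^ ((w.length : ℝ) ^ ε) := hA w hw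
      _ ≤ max A 0 * (2 : ℝ) ^ ((w.length : ℝ) ^ ε) := mul_le_mul_of_nonneg_right (le_max_left _ _) hpow
      _ = max A 0 * (2 : ℝ) ^ ((w.length : ℝ) ^ ε) * 1 := (mul_one _).symm
      _ ≤ max A 0 * (2 : ℝ) ^ ((w.length : ℝ) ^ ε) *
            (newtonVertexCount (sparseMat⟦comp⟦w⟧⟧ 0 2) : ℝ) := mul_le_mul_of_nonneg_left h1 hA0

open CancellationForms in
/-- **The polynomial form implies S2** (binder form, with the local notations). [folklore] -/
theorem cancellationSubexp_of_poly'
    (hpoly : ∃ c : ℕ, ∀ w : List (Fin 3 × Fin 3 × ℂ × (ℕ × ℕ)), (∀ l ∈ w, l.1 ≠ l.2.1) →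
      newtonVertexCount (sparseMat⟦w⟧ 0 2) ≤ c * (w.length + 1) ^ c) :
    ∀ ε : ℝ, 0 < ε → ∃ A : ℝ, ∀ w : List (Fin 3 × Fin 3 × ℂ × (ℕ × ℕ)), (∀ l ∈ w, l.1 ≠ l.2.1) →
      (newtonVertexCount (sparseMat⟦w⟧ 0 2) : ℝ) ≤
        A * (2 : ℝ) ^ ((w.length : ℝ) ^ ε) * (newtonVertexCount (sparseMat⟦comp⟦w⟧⟧ 0 2) : ℝ) := by
  obtain ⟨c, hc⟩ := hpoly
  apply cancellationSubexp_of_absolute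
  intro ε hε
  obtain ⟨A, -, hA⟩ := poly_le_mul_two_rpow c hε
  refine ⟨A, fun w hw => ?_⟩
  have h1 : (newtonVertexCount (sparseMat⟦w⟧ 0 2) : ℝ) ≤ (c : ℝ) * ((w.length : ℝ) + 1) ^ c := by
    exact_mod_cast hc w hw
  exact h1.trans (hA w.length)

/-- **The polynomial form implies S2** (registered form, notation-free): if the `(0,2)` entries of
all sparse bivariate words of length `L` have at most `c (L+1)^c` Newton vertices (the card's
`NewtonWordTauPoly`), then the registered stub `stub_cancellationSubexp` of the line holds. [folklore] -/
theorem cancellationSubexp_of_poly :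
    (∃ c : ℕ, ∀ w : List (Fin 3 × Fin 3 × ℂ × (ℕ × ℕ)), (∀ l ∈ w, l.1 ≠ l.2.1) →
      newtonVertexCount ((w.map
          (fun l : Fin 3 × Fin 3 × ℂ × (ℕ × ℕ) => Matrix.transvection l.1 l.2.1
            (MvPolynomial.C l.2.2.1 * (MvPolynomial.X 0 ^ l.2.2.2.1 * MvPolynomial.X 1 ^ l.2.2.2.2) :
              MvPolynomial (Fin 2) ℂ))).prod 0 2) ≤ c * (w.length + 1) ^ c) →
    ∀ ε : ℝ, 0 < ε → ∃ A : ℝ, ∀ w : List (Fin 3 × Fin 3 × ℂ × (ℕ × ℕ)), (∀ l ∈ w, l.1 ≠ l.2.1) →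
      (newtonVertexCount ((w.map
          (fun l : Fin 3 × Fin 3 × ℂ × (ℕ × ℕ) => Matrix.transvection l.1 l.2.1
            (MvPolynomial.C l.2.2.1 * (MvPolynomial.X 0 ^ l.2.2.2.1 * MvPolynomial.X 1 ^ l.2.2.2.2) :
              MvPolynomial (Fin 2) ℂ))).prod 0 2) : ℝ) ≤
        A * (2 : ℝ) ^ ((w.length : ℝ) ^ ε) *
          (newtonVertexCount (((w.map (fun l => (l.1, l.2.1, (1 : ℂ), l.2.2.2))).map
          (fun l : Fin 3 × Fin 3 × ℂ × (ℕ × ℕ) => Matrix.transvection l.1 l.2.1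
            (MvPolynomial.C l.2.2.1 * (MvPolynomial.X 0 ^ l.2.2.2.1 * MvPolynomial.X 1 ^ l.2.2.2.2) :
              MvPolynomial (Fin 2) ℂ))).prod 0 2) : ℝ) :=
  fun hpoly => cancellationSubexp_of_poly' hpoly

end Summit.ValiantsHypothesis.ValiantsHypothesis.Theorems.ElementaryWordLengthWordPerSuperPoly
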